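import Literature.Analysis.FluidPDE.TorusWordLeibniz
import Literature.Analysis.FunctionSpaces.TorusInverseLaplacianCalculus
import HarnessLib

/-!
# Word derivatives of space–time fields: joint smoothness and commutation with `∂ₜ` and `∂ᵢ`

Analysis/FluidPDE support file (everything proved; no named facts), sequel of `TorusWordLeibniz`.
For the energy method at arbitrary order one differentiates the equations along a word `w`; this
uses that `∂^w` commutes with the time derivative within a slab and with further space derivatives:

* `isSmoothSpaceTimeOn_wordDeriv` — `(t, x) ↦ ∂^w (U t) x` is jointly smooth on `S × 𝕋^d`;
* `timeDerivWithin_wordDeriv_comm` — `∂ₜ ∂^w U = ∂^w ∂ₜ U` within `[a, b]`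
  (from the tree's `Torus.timeDerivWithin_partialDeriv_comm`, letter by letter);
* `wordDeriv_partialDeriv_comm` — `∂^w ∂ᵢ f = ∂ᵢ ∂^w f` for smooth `f`
  (`Torus.partialDeriv_comm`, letter by letter), and `wordDeriv_append_comm`.

## References

* A. Majda, *Compressible Fluid Flow and Systems of Conservation Laws in Several Space
  Variables*, Springer 1984, Ch. 2 §2.1, proof of Thm 2.2. [`Majda1984`]
-/

noncomputable section

open Set Function
open scoped ContDiff

namespace Literature.Analysis.FluidPDE

namespace Torus

open FunctionSpaces FunctionSpaces.Torus

variable {d : Type*} [Fintype d] [DecidableEq d] {F : Type*} [NormedAddCommGroup F] [NormedSpace ℝ F]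

/-- Word derivatives of jointly smooth fields are jointly smooth (time sets of unique
differentiability). [folklore] -/
theorem isSmoothSpaceTimeOn_wordDeriv {S : Set ℝ} {U : ℝ → UnitAddTorus d → F} (hU : Torus.IsSmoothSpaceTimeOn S U)
    (hS : UniqueDiffOn ℝ S) : ∀ w : List d, Torus.IsSmoothSpaceTimeOn S (fun t => wordDeriv w (U t))
  | [] => hU
  | i :: w => (isSmoothSpaceTimeOn_wordDeriv hU hS w).partialDeriv hS i

/-- **`∂ₜ` commutes with `∂^w` within a slab.** [folklore] -/
theorem timeDerivWithin_wordDeriv_comm {a b : ℝ} (hab : a < b) {U : ℝ → UnitAddTorus d → F}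
    (hU : Torus.IsSmoothSpaceTimeOn (Icc a b) U) {t : ℝ} (ht : t ∈ Icc a b) :
    ∀ (w : List d) (x : UnitAddTorus d),
      Torus.timeDerivWithin (Icc a b) (fun s => wordDeriv w (U s)) t x = wordDeriv w (Torus.timeDerivWithin (Icc a b) U t) x
  | [], _ => rfl
  | i :: w, x => by
      have hw := isSmoothSpaceTimeOn_wordDeriv hU (uniqueDiffOn_Icc hab) w
      have h1 := timeDerivWithin_partialDeriv_comm hab hw ht i x
      simp only [wordDeriv_cons]
      rw [h1]
      congr 1
      funext y
      exact timeDerivWithin_wordDeriv_comm hab hU ht w y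

/-- **`∂^w ∂ᵢ f = ∂ᵢ ∂^w f`** for smooth `f`. [folklore] -/
theorem wordDeriv_partialDeriv_comm {f : UnitAddTorus d → F} (hf : IsSmooth f) (i : d) :
    ∀ w : List d, wordDeriv w (Torus.partialDeriv i f) = Torus.partialDeriv i (wordDeriv w f)
  | [] => rfl
  | j :: w => by
      rw [wordDeriv_cons, wordDeriv_cons, wordDeriv_partialDeriv_comm hf i w]
      funext x
      exact partialDeriv_comm (isSmooth_wordDeriv hf w) j i x

/-- `∂^{w ++ [i]} f = ∂ᵢ ∂^w f` for smooth `f` (innermost letter moved outside). [folklore] -/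
theorem wordDeriv_concat_eq_partialDeriv {f : UnitAddTorus d → F} (hf : IsSmooth f) (w : List d) (i : d) :
    wordDeriv (w ++ [i]) f = Torus.partialDeriv i (wordDeriv w f) := by
  rw [wordDeriv_concat, wordDeriv_partialDeriv_comm hf i w]

/-- Word derivatives commute: `∂^v ∂^w f = ∂^w ∂^v f` for smooth `f`. [folklore] -/
theorem wordDeriv_wordDeriv_comm {f : UnitAddTorus d → F} (hf : IsSmooth f) (v : List d) :
    ∀ w : List d, wordDeriv v (wordDeriv w f) = wordDeriv w (wordDeriv v f)
  | [] => rfl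
  | i :: w => by
      rw [wordDeriv_cons, wordDeriv_cons, ← wordDeriv_wordDeriv_comm hf v w,
        ← wordDeriv_partialDeriv_comm (isSmooth_wordDeriv hf w) i v]

end Torus

end Literature.Analysis.FluidPDE

end
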